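import Summits.BirchSwinnertonDyer.BirchSwinnertonDyer.Theses.TwoAdicConverse
import Literature.NumberTheory.EllipticCurves.GaloisAction
import HarnessLib

/-! # Birth skeleton v2 (BC3/BC5) for S3 crux `OrdLambdaHalfAtTwo`
(item stmt-BirchSwinnertonDyer-19556, rider S-1; planner bsd-2adic-plan GEN 13 → GEN 14, 2026-08-26).
Two registered stubs by RESIDUAL IMAGE at 2 (surjective: an Euler-system-free λ-inequality needs a 2-adic Eisenstein-ideal input;
non-surjective: λ-transport along 2-isogenies is exact up to μ — GV (1.2) shape) and ONE kernel-checked CLOSED composition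
`OrdLambdaHalfAtTwo_of` over the stub names (v1 failed `skeleton.extra-hypothesis`). First rungs (BC5): conv-1's eleven
`lambdaHalfAtTwo_<label>` instances (p435018, `Theorems/TwoAdicConverseLambdaHalfInstances.lean`). -/

set_option autoImplicit false
-- the Cruxes namespace of this sub repeats the summit name by design (D-0017 nested layout)
set_option linter.dupNamespace false

namespace Summit.BirchSwinnertonDyer.BirchSwinnertonDyer.Cruxes.OrdLambdaHalfAtTwo.Birth

open WeierstrassCurve Literature.NumberTheory.EllipticCurves Literature.NumberTheory.EllipticCurves.Rank1Residual
  Summit.BirchSwinnertonDyer.BirchSwinnertonDyer.Theses.TwoAdicConverse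

/-- stub (surjective image at 2). -/
theorem stub_surj : ∀ (W : WeierstrassCurve ℚ) [W.IsElliptic] [W.IsGloballyMinimal], ¬ W.HasCM → GoodOrd W 2 →
    W.HasSurjectiveModNGaloisRep 2 →
    Summit.BirchSwinnertonDyer.BirchSwinnertonDyer.Theorems.TwoAdicTwistConverse.LambdaHalfAtTwo W := by
  sorry

/-- stub (non-surjective image at 2). -/
theorem stub_nonsurj : ∀ (W : WeierstrassCurve ℚ) [W.IsElliptic] [W.IsGloballyMinimal], ¬ W.HasCM → GoodOrd W 2 →
    ¬ W.HasSurjectiveModNGaloisRep 2 →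
    Summit.BirchSwinnertonDyer.BirchSwinnertonDyer.Theorems.TwoAdicTwistConverse.LambdaHalfAtTwo W := by
  sorry

/-- composition (CLOSED over the two stub names; the ONLY theorem of this file concluding the crux). -/
theorem OrdLambdaHalfAtTwo_of :
    Summit.BirchSwinnertonDyer.BirchSwinnertonDyer.Theses.TwoAdicConverse.OrdLambdaHalfAtTwo := by
  show Summit.BirchSwinnertonDyer.BirchSwinnertonDyer.Theorems.TwoAdicTwistConverse.OrdLambdaHalfAtTwo
  intro W _ _ hcm hgo
  by_cases h : W.HasSurjectiveModNGaloisRep 2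
  · exact stub_surj W hcm hgo h
  · exact stub_nonsurj W hcm hgo h

end Summit.BirchSwinnertonDyer.BirchSwinnertonDyer.Cruxes.OrdLambdaHalfAtTwo.Birth
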